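import Literature.NumberTheory.GelbartRogawski1991.DoubledUnitaryDiagonalEmbedding
import HarnessLib

/-!
# The doubling embedding `ι : G(𝔸) × G(𝔸) ↪ H(𝔸) = U(𝕎 ⊕ 𝕎⁻)(𝔸)` (Piatetski-Shapiro–Rallis doubling, a = 0)

Topic `NumberTheory/K2Lit` (Track B build stream 29; planner `hodgecm-mathlib-K2Liu-plan`; DEFS leaf D4 remainder (i) of
`K2/K2Liu-plan/g0/DEPMAP-PRICE-184nat.v1.K2Liu-plan-g0.md` §5 — the one piece of Liu 2021 §B.3's doubling data at `a = 0` that is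
not already ★ in `GelbartRogawski1991.GRConstruction`). Plumbing definitions with bodies and proved theorems only: **no `sorry`,
no named fact, no instance, no notation.**

Setting of ★ `DoubledUnitaryGlobalSplittingData` ∕ `DoubledUnitaryDiagonalEmbedding`: CM field `L`, diagonal hermitian `V = diag dV`
(rank `N`), partner `W = diag dW` (rank `M`), `e : Fin N × Fin M ≃ Fin n`, `G₁(𝔸) = ★ UnitaryGroup.adelicPair … (diag dV) (diag dW)`
(`= U(𝕎)(𝔸)`, `𝕎 = V ⊗ W`), `H(𝔸) = ★ HA L e dV hdV dW hdW = U(𝕎 ⊕ 𝕎⁻)(𝔸)`. The tree has the DIAGONAL `★ diagG : G₁(𝔸) →* H(𝔸)`,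
`x ↦ (x, x)` (whose image lies in `P_Δ`, ★ `isSiegelDelta_diagG`). This file adds the TWO-VARIABLE embedding of the doubling
method [PSR87 §1; Liu2021 §B.3 p. 101 `ı : G × G → G^◇`; HarrisKudlaSweet1996 §1 (1.11)]:

* `iotaGG : G₁(𝔸) × G₁(𝔸) →* H(𝔸)`, `(x₁, x₂) ↦ diag(x₁, x₂)` (second block read in `U(−J)` via ★ `toNegForm`, re-enumerated by
  ★ `e₂`, cast along ★ `adelicForm_hermD_eq` — literally ★ `diagG`'s term with `MonoidHom.prodMap` for `MonoidHom.prod`);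
  `coe_iotaGG` (its `GL`-matrix), **`iotaGG_diag : iotaGG (x, x) = diagG x`** (`rfl`), `continuous_iotaGG`;
* `iotaV : U(V)(𝔸) × U(V)(𝔸) →* H(𝔸)`, `ι(g₁, g₂) := iotaGG (g₁ ⊗ 1, g₂ ⊗ 1)` (★ `adelicInl`), `iotaV_diag`, `continuous_iotaV`,
  `isSiegelDelta_iotaV_diag` (`ι(g, g) ∈ P_Δ(𝔸)` — the see-saw ∕ «`P_0 ∩ ı(G × G) = G^Δ`» half that is a containment);
* `iotaLeft : U(V)(𝔸) →* H(𝔸)`, `g ↦ ι(g, 1)` — the argument of the section in the doubling zeta integral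
  `Z(s, f, φ₁, φ₂) = ∫_{G(𝔸)} f_s(ι(g, 1)) ⟨π(g)φ₁, φ₂⟩ dg` (Liu 2021 Lem. B.11 ∕ B.12 at `a = 0`).
-/

noncomputable section

open scoped Matrix Kronecker
open NumberField IsDedekindDomain

namespace Literature.NumberTheory.K2Lit.SiegelDoubled

open Literature.NumberTheory.Automorphic Literature.NumberTheory.GaloisRepresentations
open Literature.NumberTheory.GelbartRogawski1991 Literature.NumberTheory.GelbartRogawski1991.GRConstruction

variable (L : Type) [Field L] [NumberField L] [IsCMField L]
variable {N M n : ℕ} (e : Fin N × Fin M ≃ Fin n)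
  (dV : Fin N → L) (hdV : ∀ i, IsCMField.complexConj L (dV i) = dV i)
  (dW : Fin M → L) (hdW : ∀ i, IsCMField.complexConj L (dW i) = dW i)

/-! ## 1. `ι : G₁(𝔸) × G₁(𝔸) →* H(𝔸)` -/

/-- **`ι : G₁(𝔸) × G₁(𝔸) →* H(𝔸)`, `(x₁, x₂) ↦ diag(x₁, x₂)`** — the doubling embedding (the second block read in `U(−J)` by ★
`toNegForm`, re-enumerated by ★ `e₂`, cast along ★ `adelicForm_hermD_eq`). [cite: Liu2021, §B.3 p. 101]
[cite: HarrisKudlaSweet1996, §1 (1.11)] -/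
def iotaGG : UnitaryGroup.adelicPair (Fp L) L (IsCMField.complexConj L) N M (Matrix.diagonal dV) (Matrix.diagonal dW) ×
      UnitaryGroup.adelicPair (Fp L) L (IsCMField.complexConj L) N M (Matrix.diagonal dV) (Matrix.diagonal dW) →*
    HA L e dV hdV dW hdW :=
  (Subgroup.inclusion (le_of_eq (congrArg (unitaryGroupOfForm (UnitaryGroup.conjAdele (Fp L) L (IsCMField.complexConj L)))
      (adelicForm_hermD_eq L e dV hdV dW hdW).symm))).comp <|
    (UnitaryGroup.reindexU _ (e₂ (n := n)) _).comp <|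
      (UnitaryGroup.blockDiag _ _ _).comp <|
        (MonoidHom.prodMap (UnitaryGroup.reindexU _ e _) ((toNegForm _ _).comp (UnitaryGroup.reindexU _ e _)))

/-- the `GL`-matrix of `ι(x₁, x₂)`: `reindex e₂ (diag (reindex e x₁, reindex e x₂))`. [cite: Liu2021, §B.3 p. 101] -/
theorem coe_iotaGG (x : UnitaryGroup.adelicPair (Fp L) L (IsCMField.complexConj L) N M (Matrix.diagonal dV) (Matrix.diagonal dW) ×
      UnitaryGroup.adelicPair (Fp L) L (IsCMField.complexConj L) N M (Matrix.diagonal dV) (Matrix.diagonal dW)) :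
    ((iotaGG L e dV hdV dW hdW x : HA L e dV hdV dW hdW) : GL (Fin (n + n)) (AdeleRing (𝓞 L) L)) =
      UnitaryGroup.reindexGL (e₂ (n := n))
        (UnitaryGroup.blockDiagGL (UnitaryGroup.reindexGL e (x.1 : GL (Fin N × Fin M) (AdeleRing (𝓞 L) L)),
          UnitaryGroup.reindexGL e (x.2 : GL (Fin N × Fin M) (AdeleRing (𝓞 L) L)))) :=
  rfl

/-- **On the diagonal `ι` is the tree's `diagG`**: `ι(x, x) = (x, x)`. [cite: Liu2021, §B.3 p. 101] -/
theorem iotaGG_diag (x : UnitaryGroup.adelicPair (Fp L) L (IsCMField.complexConj L) N M (Matrix.diagonal dV) (Matrix.diagonal dW)) :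
    iotaGG L e dV hdV dW hdW (x, x) = diagG L e dV hdV dW hdW x :=
  rfl

/-- `ι` is continuous. [cite: Liu2021, §B.3 p. 101] -/
theorem continuous_iotaGG : Continuous (iotaGG L e dV hdV dW hdW) := by
  refine continuous_induced_rng.2 ?_
  change Continuous fun x => ((iotaGG L e dV hdV dW hdW x : HA L e dV hdV dW hdW) : GL (Fin (n + n)) (AdeleRing (𝓞 L) L))
  simp only [coe_iotaGG]
  exact (UnitaryGroup.continuous_reindexGL _).comp (UnitaryGroup.continuous_blockDiagGL.comp
    (((UnitaryGroup.continuous_reindexGL _).comp (continuous_subtype_val.comp continuous_fst)).prodMk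
      ((UnitaryGroup.continuous_reindexGL _).comp (continuous_subtype_val.comp continuous_snd))))

/-! ## 2. `ι` on `U(V)(𝔸) × U(V)(𝔸)` and `g ↦ ι(g, 1)` -/

/-- **`ι(g₁, g₂) := ι(g₁ ⊗ 1, g₂ ⊗ 1)`** on `U(V)(𝔸) × U(V)(𝔸)` (★ `adelicInl : g ↦ g ⊗ 1`). For `M = 1` (`W` a line) `G₁ = U(V ⊗ W) = U(V)`
and this is Liu's `ı : G × G → G^◇ = U(V ⊕ −V)` at `a = 0`. [cite: Liu2021, §B.3 p. 101] [cite: HarrisKudlaSweet1996, §1 (1.11)] -/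
def iotaV : UnitaryGroup.adelic (Fp L) L (IsCMField.complexConj L) N (Matrix.diagonal dV) ×
      UnitaryGroup.adelic (Fp L) L (IsCMField.complexConj L) N (Matrix.diagonal dV) →* HA L e dV hdV dW hdW :=
  (iotaGG L e dV hdV dW hdW).comp
    (MonoidHom.prodMap (UnitaryGroup.adelicInl (Fp L) L (IsCMField.complexConj L) N M (Matrix.diagonal dV) (Matrix.diagonal dW))
      (UnitaryGroup.adelicInl (Fp L) L (IsCMField.complexConj L) N M (Matrix.diagonal dV) (Matrix.diagonal dW)))

/-- `ι(g, g) = diagG (g ⊗ 1)`. [cite: Liu2021, §B.3 p. 101] -/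
theorem iotaV_diag (g : UnitaryGroup.adelic (Fp L) L (IsCMField.complexConj L) N (Matrix.diagonal dV)) :
    iotaV L e dV hdV dW hdW (g, g) =
      diagG L e dV hdV dW hdW (UnitaryGroup.adelicInl (Fp L) L (IsCMField.complexConj L) N M (Matrix.diagonal dV) (Matrix.diagonal dW) g) :=
  rfl

/-- `ι` on `U(V)(𝔸) × U(V)(𝔸)` is continuous. [cite: Liu2021, §B.3 p. 101] -/
theorem continuous_iotaV : Continuous (iotaV L e dV hdV dW hdW) :=
  (continuous_iotaGG L e dV hdV dW hdW).comp
    ((UnitaryGroup.continuous_adelicInl (Fp L) L (IsCMField.complexConj L) N M (Matrix.diagonal dV) (Matrix.diagonal dW)).prodMap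
      (UnitaryGroup.continuous_adelicInl (Fp L) L (IsCMField.complexConj L) N M (Matrix.diagonal dV) (Matrix.diagonal dW)))

/-- **`ι(g, g) ∈ P_Δ(𝔸)`** — the diagonal `G^Δ` lies in the Siegel parabolic (★ `isSiegelDelta_diagG`); the containment half of
Liu's «`P_0 ∩ ı(G × G) = ı(G^Δ)`». [cite: Liu2021, §B.3 p. 101] [cite: Kudla1994, §2] -/
theorem isSiegelDelta_iotaV_diag (g : UnitaryGroup.adelic (Fp L) L (IsCMField.complexConj L) N (Matrix.diagonal dV)) :
    IsSiegelDelta L e dV hdV dW hdW (iotaV L e dV hdV dW hdW (g, g)) := by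
  rw [iotaV_diag]
  exact isSiegelDelta_diagG L e dV hdV dW hdW _

/-- **`g ↦ ι(g, 1)`** — the argument of the Siegel section in the doubling zeta integral
`Z(s, f, φ₁, φ₂) = ∫_{G(𝔸)} f_s(ι(g, 1)) ⟨π(g)φ₁, φ₂⟩ dg`. [cite: Liu2021, Lem. B.11 p. 102] -/
def iotaLeft : UnitaryGroup.adelic (Fp L) L (IsCMField.complexConj L) N (Matrix.diagonal dV) →* HA L e dV hdV dW hdW :=
  (iotaV L e dV hdV dW hdW).comp (MonoidHom.inl _ _)

/-- `iotaLeft g = ι(g, 1)`. [cite: Liu2021, Lem. B.11 p. 102] -/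
theorem iotaLeft_apply (g : UnitaryGroup.adelic (Fp L) L (IsCMField.complexConj L) N (Matrix.diagonal dV)) :
    iotaLeft L e dV hdV dW hdW g = iotaV L e dV hdV dW hdW (g, 1) :=
  rfl

/-- `g ↦ ι(g, 1)` is continuous. [cite: Liu2021, Lem. B.11 p. 102] -/
theorem continuous_iotaLeft : Continuous (iotaLeft L e dV hdV dW hdW) :=
  (continuous_iotaV L e dV hdV dW hdW).comp (continuous_id.prodMk continuous_const)

/-- `ι(g₁, g₂) = ι(g₁, 1) · ι(1, g₂)` and the two factors commute (a homomorphism from a product).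
[cite: Liu2021, §B.3 p. 101] -/
theorem iotaV_eq_mul (g₁ g₂ : UnitaryGroup.adelic (Fp L) L (IsCMField.complexConj L) N (Matrix.diagonal dV)) :
    iotaV L e dV hdV dW hdW (g₁, g₂) = iotaV L e dV hdV dW hdW (g₁, 1) * iotaV L e dV hdV dW hdW (1, g₂) := by
  rw [← map_mul, Prod.mk_mul_mk, mul_one, one_mul]

end Literature.NumberTheory.K2Lit.SiegelDoubled
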